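import Literature.Computability.Cryptography.WordRAMInline2
import HarnessLib

/-!
# The word RAM — inline simulation with query forwarding, I: the forwarding block

The machine behind the **transitivity of fine-grained reductions** (V. Vassilevska Williams,
R. Williams, J. ACM 65 (2018), §3, Prop. 1: "Let `A, B, C` be problems so that `A ≤_q B` and
`B ≤_q C`. Then `A ≤_q C`"; proof p. 27:11: "replace each oracle call on an instance `xᵢ` … with a
call to `P_{B,ε'}` on `xᵢ`"; also VVW ICM 2018, Prop. 2.2) runs the reduction `M_{AB}` with every
oracle call answered by an *inline run of the second reduction* `M_{BD}`, whose own oracle calls are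
**forwarded** to the real oracle. The inline run is the stamped emulation of
`Literature.Computability.Cryptography.WordRAMEmulator` in the `B`-quarters of the address space
(layout `Inline.LB`, environment `Inline.EB W g wsB` of `…WordRAMInline1`), exactly as for the
transfer property (`…WordRAMInline2/3`), except that the `query` instructions of `M_{BD}` are now
compiled to the **forwarding block** `Inline.QF` of this file:

* read the three operands of `query qa ql aa` from the emulated memory (`F0`, registers `21–23`)
  and set up addresses (`F1`);
* **normalise the query range in place** (`normBody`, `L'` rounds): every cell of the emulated
  segment is rewritten with its emulated value and restamped with the current generation, so that
  afterwards the *physical* segment at `2Q + a'` **is** the emulated query segment;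
* issue the real `query (dir 24) (dir 22) (dir 25)`: the oracle's answer lands physically at
  `2Q + ad'` (length, then the words reduced modulo `2 ^ W`), and the query enters the target's log;
* restamp the length cell (`F3`) and reduce every answer word modulo `2 ^ wsB` and restamp it
  (`fixBody`, `|O q|` rounds).

The net effect on the emulated memory is `WordRAM.step` on the `query` at the *emulated* word size
`wsB` with the *real* oracle (`run_QF`), at cost `qfCost L' |O q| = 14 L' + 11 |O q| + 47`, the
target's query log growing by exactly the emulated query.

## References

* V. Vassilevska Williams, R. R. Williams, *Subcubic equivalences between path, matrix, and
  triangle problems*, J. ACM 65 (2018), Art. 27, §3, Prop. 1 (p. 27:10, proof p. 27:11).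
  doi:10.1145/3186893
* V. Vassilevska Williams, *On some fine-grained questions in algorithms and complexity*,
  Proc. ICM 2018, §2 (Def. 2.1, Prop. 2.2).
-/

namespace Literature.Computability.Cryptography.WordRAM

open StateTransition

namespace Inline

/-! ## The forwarding block: code -/

/-- Emulated operand read in the `B`-layout into register `T`, padded with no-ops to length `12`.
[folklore] -/
def erdPadB (x : Operand) (T : ℕ) : List OpSpec :=
  erd LB x T ++ List.replicate (12 - (erd LB x T).length) nopOp

/-- Length of `erdPadB` (always `12`). [folklore] -/
@[simp] theorem erdPadB_length (x : Operand) (T : ℕ) : (erdPadB x T).length = 12 := by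
  have := length_erd_le LB x T
  simp only [erdPadB, List.length_append, List.length_replicate]; omega

/-- A padded emulated read has the semantics of the read. [folklore] -/
theorem execOps_erdPadB (W : ℕ) (mem : ℕ → ℕ) (x : Operand) (T : ℕ) :
    execOps W mem (erdPadB x T) = execOps W mem (erd LB x T) := by
  rw [erdPadB, execOps_append, execOps_replicate_nopOp]

/-- Phase 0 of the forwarding block: read the three operands of the emulated `query` into
registers `21, 22, 23`. [folklore] -/
def F0 (qa ql aa : Operand) : List OpSpec :=
  erdPadB qa 21 ++ erdPadB ql 22 ++ erdPadB aa 23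

/-- Phase 1: `R24 := R21 + 2Q` (physical query address), `R25 := R23 + 2Q` (physical answer
address), `R26 := R21` (normalisation pointer), `R27 := R22` (normalisation counter). [folklore] -/
def F1 : List OpSpec :=
  [(.add, .dir 24, .dir 21, .dir 8), (.add, .dir 25, .dir 23, .dir 8),
   (.div, .dir 26, .dir 21, .imm 1), (.div, .dir 27, .dir 22, .imm 1)]

/-- Normalisation round: rewrite the emulated cell `R26` with its own emulated value (restamping
it), `R26 += 1; R27 -= 1`. [folklore] -/
def normBody : List OpSpec :=
  erdAt LB (.dir 26) 12 ++ ewrAt LB (.dir 26) 12 ++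
    [(.add, .dir 26, .dir 26, .imm 1), (.sub, .dir 27, .dir 27, .imm 1)]

/-- Phase 3 (after the real query): `R27 :=` the answer length (physical cell `R25`);
`R14 := R23 + 3Q`; restamp the length cell; `R26 := R23 + 1` (first answer word). [folklore] -/
def F3 : List OpSpec :=
  [(.div, .dir 27, .ind 25, .imm 1), (.add, .dir 14, .dir 23, .dir 9),
   (.div, .ind 14, .dir 10, .imm 1), (.add, .dir 26, .dir 23, .imm 1)]

/-- Fix-up round: `R14 := R26 + 2Q; R12 := mem[R14] % 2 ^ wsB`; write `R12` to the emulated cell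
`R26` (restamping it); `R26 += 1; R27 -= 1`. [folklore] -/
def fixBody : List OpSpec :=
  [(.add, .dir 14, .dir 26, .dir 8), (.div, .dir 12, .ind 14, .imm 1),
    (.mod, .dir 12, .dir 12, .dir 11)] ++ ewrAt LB (.dir 26) 12 ++
    [(.add, .dir 26, .dir 26, .imm 1), (.sub, .dir 27, .dir 27, .imm 1)]

/-- **The forwarding block** at position `pos` for the emulated instruction `query qa ql aa` of
the inner reduction: operands, addresses, in-place normalisation of the query range, the real
`query`, restamping and reduction of the answer. [folklore] -/
def QF (pos : ℕ) (qa ql aa : Operand) : List Instr :=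
  (F0 qa ql aa).map OpSpec.toInstr ++ F1.map OpSpec.toInstr ++ loopBlock (pos + 40) 27 normBody ++
    [.query (.dir 24) (.dir 22) (.dir 25)] ++ F3.map OpSpec.toInstr ++
    loopBlock (pos + 59) 27 fixBody

/-- The length of the forwarding block. [folklore] -/
def qlenF : ℕ := 70

/-- Length of `F0`. [folklore] -/
@[simp] theorem F0_length (qa ql aa : Operand) : (F0 qa ql aa).length = 36 := by simp [F0]
/-- Length of `F1`. [folklore] -/
@[simp] theorem F1_length : F1.length = 4 := rfl
/-- Length of `normBody`. [folklore] -/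
@[simp] theorem normBody_length : normBody.length = 12 := rfl
/-- Length of `F3`. [folklore] -/
@[simp] theorem F3_length : F3.length = 4 := rfl
/-- Length of `fixBody`. [folklore] -/
@[simp] theorem fixBody_length : fixBody.length = 9 := rfl

/-- Length of the forwarding block (`= qlenF`). [folklore] -/
@[simp] theorem QF_length (pos : ℕ) (qa ql aa : Operand) : (QF pos qa ql aa).length = qlenF := by
  simp [QF, qlenF]

/-- The cost of the forwarding block: query of length `L`, answer of length `lo`. [folklore] -/
def qfCost (L lo : ℕ) : ℕ := 14 * L + 11 * lo + 47

/-! ## Phases 0 and 1 -/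

section phases

variable {W VT VB : ℕ}

/-- Phase 0 reads the three operands (values of the `VB`-bounded source memory `dmem`) into
registers `21, 22, 23`, keeping the `B`-side and changing only registers `14, 21, 22, 23`.
[folklore] -/
theorem execOps_F0 {g wsB : ℕ} (hW : 8 ≤ W) (hwsB : wsB ≤ W) (hVT : VT + 1 = 2 ^ W)
    {mem dmem : ℕ → ℕ} (hB : BSide W g wsB VT dmem mem) (hdm : MemLE VB dmem) (hVQ : VB < Qv W)
    (hVVT : VB ≤ VT) (qa ql aa : Operand) (hqa : qa.const ≤ VB) (hql : ql.const ≤ VB)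
    (haa : aa.const ≤ VB) :
    BSide W g wsB VT dmem (execOps W mem (F0 qa ql aa)) ∧
      (execOps W mem (F0 qa ql aa)) 21 = qa.read dmem ∧
      (execOps W mem (F0 qa ql aa)) 22 = ql.read dmem ∧
      (execOps W mem (F0 qa ql aa)) 23 = aa.read dmem ∧
      ∀ c, c ≠ 14 → c ≠ 21 → c ≠ 22 → c ≠ 23 → (execOps W mem (F0 qa ql aa)) c = mem c := by
  have hOK := envOK_B (g := g) hW hwsB
  have hQ := Qv_ge hW
  have h255 : 255 ≤ VT := by
    have : 2 ^ 8 ≤ 2 ^ W := Nat.pow_le_pow_right (by norm_num) hW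
    omega
  have hVQ' : VB < (EB W g wsB).Q := by simpa using hVQ
  obtain ⟨hI, hag⟩ := hB
  rw [F0, execOps_append, execOps_append, execOps_erdPadB, execOps_erdPadB, execOps_erdPadB]
  obtain ⟨hI₁, hv₁, hag₁, hf₁⟩ := execOps_erd hOK hVT hI hag hdm hVQ' hVVT (by omega) qa hqa (T := 21)
    (by simp) (by simp) (by simp only [EB_Bv, EB_Sv]; omega) (by omega)
  obtain ⟨hI₂, hv₂, hag₂, hf₂⟩ := execOps_erd hOK hVT hI₁ hag₁ hdm hVQ' hVVT (by omega) ql hql (T := 22)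
    (by simp) (by simp) (by simp only [EB_Bv, EB_Sv]; omega) (by omega)
  obtain ⟨hI₃, hv₃, hag₃, hf₃⟩ := execOps_erd hOK hVT hI₂ hag₂ hdm hVQ' hVVT (by omega) aa haa (T := 23)
    (by simp) (by simp) (by simp only [EB_Bv, EB_Sv]; omega) (by omega)
  simp only [LB_ta] at hf₁ hf₂ hf₃
  refine ⟨⟨hI₃, hag₃⟩, ?_, ?_, hv₃, fun c h14 h21 h22 h23 => ?_⟩
  · rw [hf₃ _ (by decide) (by decide), hf₂ _ (by decide) (by decide), hv₁]
  · rw [hf₃ _ (by decide) (by decide), hv₂]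
  · rw [hf₃ _ h23 h14, hf₂ _ h22 h14, hf₁ _ h21 h14]

/-- Phase 1: with `a', L', ad'` in registers `21, 22, 23` (all `≤ VB < Q`) and `2Q` in register
`8`, afterwards registers `24, 25, 26, 27` hold `2Q + a', 2Q + ad', a', L'`; nothing else changes.
[folklore] -/
theorem execOps_F1 (hW : 8 ≤ W) (mem : ℕ → ℕ) {a L ad : ℕ} (h21 : mem 21 = a) (h22 : mem 22 = L)
    (h23 : mem 23 = ad) (h8 : mem 8 = 2 * Qv W) (ha : a < Qv W) (had : ad < Qv W) :
    (execOps W mem F1) 24 = 2 * Qv W + a ∧ (execOps W mem F1) 25 = 2 * Qv W + ad ∧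
      (execOps W mem F1) 26 = a ∧ (execOps W mem F1) 27 = L ∧
      ∀ c, c ≠ 24 → c ≠ 25 → c ≠ 26 → c ≠ 27 → (execOps W mem F1) c = mem c := by
  have h4Q := four_mul_Qv (show 2 ≤ W by omega)
  simp only [F1, execOps_cons, execOps_nil, execOp_dir, Operand.read_dir, Operand.read_imm,
    BinOp.eval, Nat.div_one]
  simp (config := { decide := true }) only [Function.update_self, Function.update_of_ne, ne_eq,
    h21, h22, h23, h8, Nat.mod_eq_of_lt (show a + 2 * Qv W < 2 ^ W by omega),
    Nat.mod_eq_of_lt (show ad + 2 * Qv W < 2 ^ W by omega)]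
  refine ⟨Nat.add_comm _ _, Nat.add_comm _ _, trivial, trivial, fun c c24 c25 c26 c27 => ?_⟩
  simp (config := { decide := true }) only [Function.update_of_ne, ne_eq, c24, c25, c26, c27,
    not_false_eq_true]


/-! ## The normalisation loop -/

/-- **One normalisation round.** With the `B`-side for `dmem`, pointer `a + j` in register `26`
(`a + L ≤ Q`), counter `L - j` in register `27`, and the first `j` cells of the segment already
physical (`mem (2Q + a + j') = dmem (a + j')`), one round keeps the `B`-side, advances the
registers and makes cell `j` physical too; only registers `12, 14, 26, 27` and `B`-region cells
change. [folklore] -/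
theorem execOps_normBody {g wsB : ℕ} (hW : 8 ≤ W) (hwsB : wsB ≤ W) (hVT : VT + 1 = 2 ^ W)
    {mem dmem : ℕ → ℕ} {a L j : ℕ} (hB : BSide W g wsB VT dmem mem)
    (h26 : mem 26 = a + j) (h27 : mem 27 = L - j) (hjL : j < L) (haL : a + L ≤ Qv W)
    (hphys : ∀ j', j' < j → mem (2 * Qv W + (a + j')) = dmem (a + j')) :
    BSide W g wsB VT dmem (execOps W mem normBody) ∧
      (execOps W mem normBody) 26 = a + (j + 1) ∧ (execOps W mem normBody) 27 = L - (j + 1) ∧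
      (∀ j', j' < j + 1 → (execOps W mem normBody) (2 * Qv W + (a + j')) = dmem (a + j')) ∧
      ∀ c, c ≠ 12 → c ≠ 14 → c ≠ 26 → c ≠ 27 → ¬ (2 * Qv W ≤ c ∧ c < 4 * Qv W) →
        (execOps W mem normBody) c = mem c := by
  have hOK := envOK_B (g := g) hW hwsB
  have hQ := Qv_ge hW
  have h4Q := four_mul_Qv (show 2 ≤ W by omega)
  have h255 : 255 ≤ VT := by
    have : 2 ^ 8 ≤ 2 ^ W := Nat.pow_le_pow_right (by norm_num) hW
    omega
  rw [normBody, execOps_append, execOps_append]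
  -- the emulated read of cell `a + j`
  obtain ⟨hI₁, hv₁, hf₁⟩ := hB.1.erdAt hOK hVT (src := .dir 26) (T := 12)
    (operandStable_dir fun c hc => by simp only [LB_ta] at hc; omega)
    (by simp) (by simp) (by simp only [EB_Bv, EB_Sv]; omega)
    (by simp only [Operand.read_dir, EB_Q, h26]; omega) (by simp only [Operand.const_dir]; omega)
    (by omega) (by omega)
  simp only [Operand.read_dir, LB_ta, h26] at hv₁ hf₁
  set m₁ := execOps W mem (erdAt LB (.dir 26) 12) with hm₁
  have h12₁ : m₁ 12 = dmem (a + j) := by rw [hv₁]; exact hB.2 _ (by simp only [EB_Q]; omega)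
  have hB₁ : BSide W g wsB VT dmem m₁ := hB.of_frame hW hI₁.memT fun c hc => hf₁ c (by omega) (by omega)
  -- the stamped write-back
  have h26₁ : m₁ 26 = a + j := by rw [hf₁ _ (by decide) (by decide), h26]
  have hdst : OperandStable (.dir 26) fun c => c = LB.ta ∨ (EB W g wsB).Bv ≤ c ∨ (EB W g wsB).Sv ≤ c :=
    operandStable_dir fun c hc => by simp only [LB_ta, EB_Bv, EB_Sv] at hc; omega
  have haQ : (Operand.dir 26).read m₁ < (EB W g wsB).Q := by
    simp only [Operand.read_dir, EB_Q, h26₁]; omega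
  obtain ⟨hI₂, hag₂, hf₂⟩ := execOps_ewrAt_agree hOK hVT hB₁.1 hB₁.2 hdst (Tv := 12) (by simp) haQ
    (by simp only [Operand.const_dir]; omega) (by omega) (by omega)
  obtain ⟨hcell, -, -⟩ := execOps_ewrAt hOK hB₁.1.env hdst (Tv := 12) (by simp) haQ
  simp only [Operand.read_dir, LB_ta, EB_Bv, EB_Sv, h26₁, h12₁] at hag₂ hf₂ hcell
  rw [Function.update_eq_self] at hag₂
  set m₂ := execOps W m₁ (ewrAt LB (.dir 26) 12) with hm₂
  -- registers
  have h26₂ : m₂ 26 = a + j := by rw [hf₂ _ (by omega) (by omega) (by omega), h26₁]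
  have h27₂ : m₂ 27 = L - j := by
    rw [hf₂ _ (by omega) (by omega) (by omega), hf₁ _ (by decide) (by decide), h27]
  set m₃ := execOps W m₂ [(.add, .dir 26, .dir 26, .imm 1), (.sub, .dir 27, .dir 27, .imm 1)] with hm₃
  have hm₃v : m₃ = Function.update (Function.update m₂ 26 (a + (j + 1))) 27 (L - (j + 1)) := by
    simp only [hm₃, execOps_cons, execOps_nil, execOp_dir, Operand.read_dir, Operand.read_imm,
      BinOp.eval, h26₂]
    simp (config := { decide := true }) only [Function.update_of_ne, ne_eq, h27₂,
      Nat.mod_eq_of_lt (show a + (j + 1) < 2 ^ W by omega),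
      sub_eval_of_le (show 1 ≤ L - j by omega) (show L - j < 2 ^ W by omega),
      show a + j + 1 = a + (j + 1) by omega, show L - j - 1 = L - (j + 1) by omega]
  have hf₃ : ∀ c, c ≠ 26 → c ≠ 27 → m₃ c = m₂ c := fun c c26 c27 => by
    rw [hm₃v, Function.update_of_ne c27, Function.update_of_ne c26]
  have hT₃ : MemLE VT m₃ := by
    intro c; rw [hm₃v]; simp only [Function.update_apply]
    split_ifs
    · omega
    · omega
    · exact hI₂.memT c
  refine ⟨(show BSide W g wsB VT dmem m₂ from ⟨hI₂, hag₂⟩).of_frame hW hT₃ fun c hc =>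
      hf₃ c (by omega) (by omega), by rw [hm₃v]; simp, by rw [hm₃v]; simp, fun j' hj' => ?_,
    fun c c12 c14 c26 c27 cB => ?_⟩
  · rw [hf₃ _ (by omega) (by omega)]
    rcases Nat.lt_or_ge j' j with h | h
    · rw [hf₂ _ (by omega) (by omega) (by omega), hf₁ _ (by omega) (by omega)]; exact hphys j' h
    · have hjj : j' = j := by omega
      subst hjj; exact hcell
  · rw [hf₃ c c26 c27, hf₂ c c14 (by omega) (by omega), hf₁ c c12 c14]

/-- **The normalisation loop**: after `j ≤ L` rounds the first `j` cells of the emulated segment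
are physical. [folklore] -/
theorem iterate_normBody {g wsB : ℕ} (hW : 8 ≤ W) (hwsB : wsB ≤ W) (hVT : VT + 1 = 2 ^ W)
    {mem dmem : ℕ → ℕ} {a L : ℕ} (hB : BSide W g wsB VT dmem mem)
    (h26 : mem 26 = a) (h27 : mem 27 = L) (haL : a + L ≤ Qv W) :
    ∀ j, j ≤ L →
      BSide W g wsB VT dmem ((fun m => execOps W m normBody)^[j] mem) ∧
      ((fun m => execOps W m normBody)^[j] mem) 26 = a + j ∧
      ((fun m => execOps W m normBody)^[j] mem) 27 = L - j ∧
      (∀ j', j' < j → ((fun m => execOps W m normBody)^[j] mem) (2 * Qv W + (a + j')) = dmem (a + j')) ∧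
      ∀ c, c ≠ 12 → c ≠ 14 → c ≠ 26 → c ≠ 27 → ¬ (2 * Qv W ≤ c ∧ c < 4 * Qv W) →
        ((fun m => execOps W m normBody)^[j] mem) c = mem c
  | 0, _ => ⟨hB, by simpa using h26, by simpa using h27, fun _ h => absurd h (Nat.not_lt_zero _),
      fun _ _ _ _ _ _ => rfl⟩
  | j + 1, hj => by
      obtain ⟨iB, i26, i27, iph, i_f⟩ := iterate_normBody hW hwsB hVT hB h26 h27 haL j (by omega)
      rw [Function.iterate_succ_apply']
      obtain ⟨jB, j26, j27, jph, jf⟩ := execOps_normBody hW hwsB hVT iB i26 i27 (by omega) haL iph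
      exact ⟨jB, j26, j27, jph, fun c c12 c14 c26 c27 cB => by
        rw [jf c c12 c14 c26 c27 cB, i_f c c12 c14 c26 c27 cB]⟩


/-! ## The real query and phase 3 -/

/-- The source memory after the emulated `query` answered by `oq`: the answer length at `ad`, the
answer words reduced modulo `2 ^ wsB` after it (the memory effect of `WordRAM.step`). [folklore] -/
def dmQ (dmem : ℕ → ℕ) (wsB ad : ℕ) (oq : List ℕ) : ℕ → ℕ :=
  writeSeg (Function.update dmem ad (oq.map (· % 2 ^ wsB)).length) (ad + 1) (oq.map (· % 2 ^ wsB))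

/-- `dmQ` off the answer range. [folklore] -/
theorem dmQ_apply_of_not (dmem : ℕ → ℕ) (wsB ad : ℕ) (oq : List ℕ) {x : ℕ}
    (hx : ¬ (ad ≤ x ∧ x < ad + 1 + oq.length)) : dmQ dmem wsB ad oq x = dmem x := by
  unfold dmQ
  rw [writeSeg_apply, dif_neg (by simp only [List.length_map]; omega), Function.update_of_ne (by omega)]

/-- `dmQ` at the length cell. [folklore] -/
theorem dmQ_apply_ad (dmem : ℕ → ℕ) (wsB ad : ℕ) (oq : List ℕ) : dmQ dmem wsB ad oq ad = oq.length := by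
  unfold dmQ
  rw [writeSeg_apply_of_lt _ _ _ _ (Nat.lt_succ_self ad), Function.update_self, List.length_map]

/-- `dmQ` at an answer word. [folklore] -/
theorem dmQ_apply_word (dmem : ℕ → ℕ) (wsB ad : ℕ) (oq : List ℕ) {i : ℕ} (hi : i < oq.length) :
    dmQ dmem wsB ad oq (ad + 1 + i) = oq[i] % 2 ^ wsB := by
  unfold dmQ
  rw [writeSeg_apply_add _ _ _ _ (by simpa using hi), List.getElem_map]

/-- **The memory after the real query.** With the target invariant, agreement with `dmem`, and the
answer `oq` (`|oq| ≤ VB`, `ad ≤ VB`, `2 VB + 2 ≤ Q`) written physically at `2Q + ad` as by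
`WordRAM.step` at word size `W`: the target invariant persists, the emulated memory still agrees with
`dmem` off the answer range, the length cell and the answer words are physical, and nothing outside
the physical answer range changed. [folklore] -/
theorem query_effect {g wsB : ℕ} (hW : 8 ≤ W) (hVT : VT + 1 = 2 ^ W)
    {mem dmem : ℕ → ℕ} (hI : TInv LB (EB W g wsB) VT mem) (hag : Agree (EB W g wsB) mem dmem)
    {ad : ℕ} {oq : List ℕ} (had : ad ≤ VB) (hoq : oq.length ≤ VB) (hVBQ : 2 * VB + 2 ≤ Qv W) :
    let mem' := writeSeg (Function.update mem (2 * Qv W + ad) (oq.map (· % 2 ^ W)).length)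
      (2 * Qv W + ad + 1) (oq.map (· % 2 ^ W))
    TInv LB (EB W g wsB) VT mem' ∧
      (∀ x, x < Qv W → ¬ (ad ≤ x ∧ x < ad + 1 + oq.length) → edec (EB W g wsB) mem' x = dmem x) ∧
      mem' (2 * Qv W + ad) = oq.length ∧
      (∀ i (hi : i < oq.length), mem' (2 * Qv W + (ad + 1 + i)) = oq[i] % 2 ^ W) ∧
      ∀ c, ¬ (2 * Qv W + ad ≤ c ∧ c < 2 * Qv W + ad + 1 + oq.length) → mem' c = mem c := by
  intro mem'
  have hQ := Qv_ge hW
  have h4Q := four_mul_Qv (show 2 ≤ W by omega)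
  have h255 : 255 ≤ VT := by
    have : 2 ^ 8 ≤ 2 ^ W := Nat.pow_le_pow_right (by norm_num) hW
    omega
  have hf : ∀ c, ¬ (2 * Qv W + ad ≤ c ∧ c < 2 * Qv W + ad + 1 + oq.length) → mem' c = mem c := by
    intro c hc
    show writeSeg _ _ _ c = mem c
    rw [writeSeg_apply, dif_neg (by simp only [List.length_map]; omega), Function.update_of_ne (by omega)]
  have hlen : mem' (2 * Qv W + ad) = oq.length := by
    show writeSeg _ _ _ _ = _
    rw [writeSeg_apply_of_lt _ _ _ _ (Nat.lt_succ_self _), Function.update_self, List.length_map]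
  have hword : ∀ i (hi : i < oq.length), mem' (2 * Qv W + (ad + 1 + i)) = oq[i] % 2 ^ W := by
    intro i hi
    show writeSeg _ _ _ _ = _
    rw [show 2 * Qv W + (ad + 1 + i) = 2 * Qv W + ad + 1 + i by omega,
      writeSeg_apply_add _ _ _ _ (by simpa using hi), List.getElem_map]
  obtain ⟨⟨e8, e9, e10, e11⟩, hst, hT⟩ := hI
  simp only [LB_rB, LB_rS, LB_rGen, LB_rP, EB_Bv, EB_Sv, EB_Gv, EB_ws] at e8 e9 e10 e11
  refine ⟨⟨⟨?_, ?_, ?_, ?_⟩, fun x hx => ?_, ?_⟩, fun x hx hnot => ?_, hlen, hword, hf⟩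
  · rw [LB_rB, EB_Bv, hf 8 (by omega), e8]
  · rw [LB_rS, EB_Sv, hf 9 (by omega), e9]
  · rw [LB_rGen, EB_Gv, hf 10 (by omega), e10]
  · rw [LB_rP, EB_ws, hf 11 (by omega), e11]
  · simp only [EB_Q] at hx
    simp only [EB_Sv, EB_Gv]
    rw [hf _ (by omega)]
    exact hst x (by simpa using hx)
  · show MemLE VT (writeSeg _ _ _)
    refine writeSeg_memLE _ _ _ (fun b => ?_) fun v hv => ?_
    · rcases eq_or_ne b (2 * Qv W + ad) with rfl | h
      · rw [Function.update_self, List.length_map]; omega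
      · rw [Function.update_of_ne h]; exact hT b
    · obtain ⟨u, -, rfl⟩ := List.mem_map.1 hv
      have := Nat.mod_lt u (Nat.two_pow_pos W); omega
  · rw [← hag x (by simpa using hx)]
    exact edec_congr (hf _ (by simp only [EB_Sv]; omega)) (hf _ (by simp only [EB_Bv]; omega))

/-- Phase 3: with `2Q + ad` in register `25`, `ad` in register `23`, `3Q` in register `9`, the
generation `g` in register `10`, and the answer length `lo` physical at `2Q + ad`: afterwards
registers `27, 26` hold `lo, ad + 1`, the stamp of `ad` is `g`, and only registers `14, 26, 27`
and that stamp changed. [folklore] -/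
theorem execOps_F3 (hW : 8 ≤ W) (mem : ℕ → ℕ) {g ad lo : ℕ} (h25 : mem 25 = 2 * Qv W + ad)
    (h23 : mem 23 = ad) (h9 : mem 9 = 3 * Qv W) (h10 : mem 10 = g) (hlen : mem (2 * Qv W + ad) = lo)
    (had : ad + 1 < Qv W) :
    (execOps W mem F3) 27 = lo ∧ (execOps W mem F3) 26 = ad + 1 ∧
      (execOps W mem F3) (3 * Qv W + ad) = g ∧ (execOps W mem F3) 14 = 3 * Qv W + ad ∧
      ∀ c, c ≠ 14 → c ≠ 26 → c ≠ 27 → c ≠ 3 * Qv W + ad → (execOps W mem F3) c = mem c := by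
  have hQ := Qv_ge hW
  have h4Q := four_mul_Qv (show 2 ≤ W by omega)
  rw [F3]
  set m₁ := execOps W mem [(.div, .dir 27, .ind 25, .imm 1), (.add, .dir 14, .dir 23, .dir 9)] with hm₁
  have hm₁v : m₁ = Function.update (Function.update mem 27 lo) 14 (3 * Qv W + ad) := by
    simp only [hm₁, execOps_cons, execOps_nil, execOp_dir, Operand.read_dir, Operand.read_ind,
      Operand.read_imm, BinOp.eval, Nat.div_one, h25, hlen]
    simp (config := { decide := true }) only [Function.update_of_ne, ne_eq, h23, h9,
      Nat.mod_eq_of_lt (show 3 * Qv W + ad < 2 ^ W by omega), show ad + 3 * Qv W = 3 * Qv W + ad by omega]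
  have hrest : execOps W mem ([(.div, .dir 27, .ind 25, .imm 1), (.add, .dir 14, .dir 23, .dir 9)] ++
      [(.div, .ind 14, .dir 10, .imm 1), (.add, .dir 26, .dir 23, .imm 1)]) =
      execOps W m₁ [(.div, .ind 14, .dir 10, .imm 1), (.add, .dir 26, .dir 23, .imm 1)] := by
    rw [execOps_append]
  rw [show ([(.div, .dir 27, .ind 25, .imm 1), (.add, .dir 14, .dir 23, .dir 9),
      (.div, .ind 14, .dir 10, .imm 1), (.add, .dir 26, .dir 23, .imm 1)] : List OpSpec) =
      [(.div, .dir 27, .ind 25, .imm 1), (.add, .dir 14, .dir 23, .dir 9)] ++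
      [(.div, .ind 14, .dir 10, .imm 1), (.add, .dir 26, .dir 23, .imm 1)] from rfl, hrest]
  have h14₁ : m₁ 14 = 3 * Qv W + ad := by rw [hm₁v]; simp
  have h10₁ : m₁ 10 = g := by rw [hm₁v]; simp (config := { decide := true }) [h10]
  have h23₁ : m₁ 23 = ad := by rw [hm₁v]; simp (config := { decide := true }) [h23]
  set m₂ := execOps W m₁ [(.div, .ind 14, .dir 10, .imm 1), (.add, .dir 26, .dir 23, .imm 1)] with hm₂
  have hm₂v : m₂ = Function.update (Function.update m₁ (3 * Qv W + ad) g) 26 (ad + 1) := by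
    simp only [hm₂, execOps_cons, execOps_nil, execOp_dir, execOp_ind, Operand.read_dir,
      Operand.read_imm, BinOp.eval, Nat.div_one, h14₁, h10₁]
    rw [Function.update_of_ne (show (23 : ℕ) ≠ 3 * Qv W + ad by omega), h23₁,
      Nat.mod_eq_of_lt (show ad + 1 < 2 ^ W by omega)]
  refine ⟨?_, ?_, ?_, ?_, fun c c14 c26 c27 cS => ?_⟩
  · rw [hm₂v, Function.update_of_ne (by omega), Function.update_of_ne (by omega), hm₁v]
    simp (config := { decide := true })
  · rw [hm₂v]; simp
  · rw [hm₂v, Function.update_of_ne (by omega), Function.update_self]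
  · rw [hm₂v, Function.update_of_ne (by omega), Function.update_of_ne (by omega), h14₁]
  · rw [hm₂v, Function.update_of_ne c26, Function.update_of_ne cS, hm₁v, Function.update_of_ne c14,
      Function.update_of_ne c27]

/-! ## The fix-up loop -/

/-- **One fix-up round.** Invariant before round `j < |oq|`: the target invariant; the emulated
memory agrees with `dmQ dmem wsB ad oq` off the window `[ad + 1 + j, ad + 1 + |oq|)`; the answer
words `j, j + 1, …` are still physical (reduced modulo `2 ^ W`) at `2Q + ad + 1 + ·`; registers
`26, 27` hold `ad + 1 + j` and `|oq| - j`. One round re-establishes it for `j + 1`, changing only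
registers `12, 14, 26, 27` and `B`-region cells. [folklore] -/
theorem execOps_fixBody {g wsB : ℕ} (hW : 8 ≤ W) (hwsB : wsB ≤ W) (hVT : VT + 1 = 2 ^ W)
    {mem dmem : ℕ → ℕ} {ad j : ℕ} {oq : List ℕ} (hI : TInv LB (EB W g wsB) VT mem)
    (hag : ∀ x, x < Qv W → ¬ (ad + 1 + j ≤ x ∧ x < ad + 1 + oq.length) →
      edec (EB W g wsB) mem x = dmQ dmem wsB ad oq x)
    (hphys : ∀ i, j ≤ i → ∀ (hi : i < oq.length), mem (2 * Qv W + (ad + 1 + i)) = oq[i] % 2 ^ W)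
    (h26 : mem 26 = ad + 1 + j) (h27 : mem 27 = oq.length - j) (hj : j < oq.length)
    (hadQ : ad + 1 + oq.length ≤ Qv W) :
    TInv LB (EB W g wsB) VT (execOps W mem fixBody) ∧
      (∀ x, x < Qv W → ¬ (ad + 1 + (j + 1) ≤ x ∧ x < ad + 1 + oq.length) →
        edec (EB W g wsB) (execOps W mem fixBody) x = dmQ dmem wsB ad oq x) ∧
      (∀ i, j + 1 ≤ i → ∀ (hi : i < oq.length),
        (execOps W mem fixBody) (2 * Qv W + (ad + 1 + i)) = oq[i] % 2 ^ W) ∧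
      (execOps W mem fixBody) 26 = ad + 1 + (j + 1) ∧
      (execOps W mem fixBody) 27 = oq.length - (j + 1) ∧
      ∀ c, c ≠ 12 → c ≠ 14 → c ≠ 26 → c ≠ 27 → ¬ (2 * Qv W ≤ c ∧ c < 4 * Qv W) →
        (execOps W mem fixBody) c = mem c := by
  have hOK := envOK_B (g := g) hW hwsB
  have hQ := Qv_ge hW
  have h4Q := four_mul_Qv (show 2 ≤ W by omega)
  have h255 : 255 ≤ VT := by
    have : 2 ^ 8 ≤ 2 ^ W := Nat.pow_le_pow_right (by norm_num) hW
    omega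
  have hP : mem 11 = 2 ^ wsB := by have := hI.env.2.2.2; simpa using this
  have h8 : mem 8 = 2 * Qv W := by have := hI.env.1; simpa using this
  have hdvd : 2 ^ wsB ∣ 2 ^ W := Nat.pow_dvd_pow 2 hwsB
  rw [fixBody, execOps_append, execOps_append]
  -- ops 1–3: fetch the physical word and reduce it
  set ma := execOp W mem (.add, .dir 14, .dir 26, .dir 8) with hma
  have hmav : ma = Function.update mem 14 (2 * Qv W + (ad + 1 + j)) := by
    rw [hma, execOp_dir]; congr 1
    simp only [BinOp.eval, Operand.read_dir, h26, h8]
    rw [Nat.mod_eq_of_lt (by omega)]; omega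
  set mb := execOp W ma (.div, .dir 12, .ind 14, .imm 1) with hmb
  have hmbv : mb = Function.update ma 12 (oq[j] % 2 ^ W) := by
    rw [hmb, execOp_dir]; congr 1
    simp only [Operand.read_ind, Operand.read_imm, BinOp.eval_div_one]
    rw [hmav, Function.update_self, Function.update_of_ne (by omega)]
    exact hphys j le_rfl hj
  set mc := execOp W mb (.mod, .dir 12, .dir 12, .dir 11) with hmc
  have hmcv : mc = Function.update mb 12 (oq[j] % 2 ^ wsB) := by
    rw [hmc, execOp_dir]; congr 1
    simp only [BinOp.eval, Operand.read_dir]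
    rw [hmbv, Function.update_self, Function.update_of_ne (by decide), hmav,
      Function.update_of_ne (by decide), hP, Nat.mod_mod_of_dvd _ hdvd]
  set m₁ := execOps W mem [(.add, .dir 14, .dir 26, .dir 8), (.div, .dir 12, .ind 14, .imm 1),
    (.mod, .dir 12, .dir 12, .dir 11)] with hm₁
  have hm₁v : m₁ = Function.update (Function.update mem 14 (2 * Qv W + (ad + 1 + j))) 12
      (oq[j] % 2 ^ wsB) := by
    rw [show m₁ = mc from rfl, hmcv, hmbv, hmav, Function.update_idem]
  have hf₁ : ∀ c, c ≠ 12 → c ≠ 14 → m₁ c = mem c := fun c c12 c14 => by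
    rw [hm₁v, Function.update_of_ne c12, Function.update_of_ne c14]
  have hT₁ : MemLE VT m₁ := by
    intro c; rw [hm₁v]; simp only [Function.update_apply]
    split_ifs
    · have := Nat.mod_lt oq[j] (Nat.two_pow_pos wsB)
      have := Nat.pow_le_pow_right (show 0 < 2 by norm_num) hwsB
      omega
    · omega
    · exact hI.memT c
  have hI₁ : TInv LB (EB W g wsB) VT m₁ := by
    refine ⟨⟨?_, ?_, ?_, ?_⟩, fun x hx => ?_, hT₁⟩
    · rw [LB_rB, hf₁ 8 (by decide) (by decide)]; exact hI.env.1
    · rw [LB_rS, hf₁ 9 (by decide) (by decide)]; exact hI.env.2.1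
    · rw [LB_rGen, hf₁ 10 (by decide) (by decide)]; exact hI.env.2.2.1
    · rw [LB_rP, hf₁ 11 (by decide) (by decide)]; exact hI.env.2.2.2
    · simp only [EB_Q] at hx; simp only [EB_Sv]
      rw [hf₁ _ (by omega) (by omega)]; exact hI.stamp x (by simpa using hx)
  have hed₁ : ∀ x, x < Qv W → edec (EB W g wsB) m₁ x = edec (EB W g wsB) mem x := fun x hx =>
    edec_congr (hf₁ _ (by simp only [EB_Sv]; omega) (by simp only [EB_Sv]; omega))
      (hf₁ _ (by simp only [EB_Bv]; omega) (by simp only [EB_Bv]; omega))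
  -- the stamped write
  have h26₁ : m₁ 26 = ad + 1 + j := by rw [hf₁ _ (by decide) (by decide), h26]
  have h12₁ : m₁ 12 = oq[j] % 2 ^ wsB := by rw [hm₁v, Function.update_self]
  have hdst : OperandStable (.dir 26) fun c => c = LB.ta ∨ (EB W g wsB).Bv ≤ c ∨ (EB W g wsB).Sv ≤ c :=
    operandStable_dir fun c hc => by simp only [LB_ta, EB_Bv, EB_Sv] at hc; omega
  have haQ : (Operand.dir 26).read m₁ < (EB W g wsB).Q := by
    simp only [Operand.read_dir, EB_Q, h26₁]; omega
  obtain ⟨hI₂, hag₂, hf₂⟩ := execOps_ewrAt_agree hOK hVT hI₁ (dmem := edec (EB W g wsB) m₁)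
    (fun _ _ => rfl) hdst (Tv := 12) (by simp) haQ (by simp only [Operand.const_dir]; omega)
    (by omega) (by omega)
  simp only [Operand.read_dir, LB_ta, EB_Bv, EB_Sv, h26₁, h12₁] at hag₂ hf₂
  set m₂ := execOps W m₁ (ewrAt LB (.dir 26) 12) with hm₂
  -- registers
  have h26₂ : m₂ 26 = ad + 1 + j := by rw [hf₂ _ (by omega) (by omega) (by omega), h26₁]
  have h27₂ : m₂ 27 = oq.length - j := by
    rw [hf₂ _ (by omega) (by omega) (by omega), hf₁ _ (by decide) (by decide), h27]
  set m₃ := execOps W m₂ [(.add, .dir 26, .dir 26, .imm 1), (.sub, .dir 27, .dir 27, .imm 1)] with hm₃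
  have hm₃v : m₃ = Function.update (Function.update m₂ 26 (ad + 1 + (j + 1))) 27
      (oq.length - (j + 1)) := by
    simp only [hm₃, execOps_cons, execOps_nil, execOp_dir, Operand.read_dir, Operand.read_imm,
      BinOp.eval, h26₂]
    simp (config := { decide := true }) only [Function.update_of_ne, ne_eq, h27₂,
      Nat.mod_eq_of_lt (show ad + 1 + (j + 1) < 2 ^ W by omega),
      sub_eval_of_le (show 1 ≤ oq.length - j by omega) (show oq.length - j < 2 ^ W by omega),
      show ad + 1 + j + 1 = ad + 1 + (j + 1) by omega,
      show oq.length - j - 1 = oq.length - (j + 1) by omega]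
  have hf₃ : ∀ c, c ≠ 26 → c ≠ 27 → m₃ c = m₂ c := fun c c26 c27 => by
    rw [hm₃v, Function.update_of_ne c27, Function.update_of_ne c26]
  have hT₃ : MemLE VT m₃ := by
    intro c; rw [hm₃v]; simp only [Function.update_apply]
    split_ifs
    · omega
    · omega
    · exact hI₂.memT c
  have hI₃ : TInv LB (EB W g wsB) VT m₃ := by
    refine ⟨⟨?_, ?_, ?_, ?_⟩, fun x hx => ?_, hT₃⟩
    · rw [LB_rB, hf₃ 8 (by decide) (by decide)]; exact hI₂.env.1
    · rw [LB_rS, hf₃ 9 (by decide) (by decide)]; exact hI₂.env.2.1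
    · rw [LB_rGen, hf₃ 10 (by decide) (by decide)]; exact hI₂.env.2.2.1
    · rw [LB_rP, hf₃ 11 (by decide) (by decide)]; exact hI₂.env.2.2.2
    · simp only [EB_Q] at hx; simp only [EB_Sv]
      rw [hf₃ _ (by omega) (by omega)]; exact hI₂.stamp x (by simpa using hx)
  have hed₃ : ∀ x, x < Qv W → edec (EB W g wsB) m₃ x = edec (EB W g wsB) m₂ x := fun x hx =>
    edec_congr (hf₃ _ (by simp only [EB_Sv]; omega) (by simp only [EB_Sv]; omega))
      (hf₃ _ (by simp only [EB_Bv]; omega) (by simp only [EB_Bv]; omega))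
  refine ⟨hI₃, fun x hx hnot => ?_, fun i hi hio => ?_, by rw [hm₃v]; simp, by rw [hm₃v]; simp,
    fun c c12 c14 c26 c27 cB => ?_⟩
  · rw [hed₃ x hx, hag₂ x (by simpa using hx)]
    rcases eq_or_ne x (ad + 1 + j) with rfl | hne
    · rw [Function.update_self, dmQ_apply_word _ _ _ _ hj]
    · rw [Function.update_of_ne hne, hed₁ x hx]
      exact hag x hx (by omega)
  · rw [hf₃ _ (by omega) (by omega), hf₂ _ (by omega) (by omega) (by omega), hf₁ _ (by omega) (by omega)]
    exact hphys i (by omega) hio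
  · rw [hf₃ c c26 c27, hf₂ c c14 (by omega) (by omega), hf₁ c c12 c14]

/-- **The fix-up loop**: after `j ≤ |oq|` rounds. [folklore] -/
theorem iterate_fixBody {g wsB : ℕ} (hW : 8 ≤ W) (hwsB : wsB ≤ W) (hVT : VT + 1 = 2 ^ W)
    {mem dmem : ℕ → ℕ} {ad : ℕ} {oq : List ℕ} (hI : TInv LB (EB W g wsB) VT mem)
    (hag : ∀ x, x < Qv W → ¬ (ad + 1 ≤ x ∧ x < ad + 1 + oq.length) →
      edec (EB W g wsB) mem x = dmQ dmem wsB ad oq x)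
    (hphys : ∀ i (hi : i < oq.length), mem (2 * Qv W + (ad + 1 + i)) = oq[i] % 2 ^ W)
    (h26 : mem 26 = ad + 1) (h27 : mem 27 = oq.length) (hadQ : ad + 1 + oq.length ≤ Qv W) :
    ∀ j, j ≤ oq.length →
      TInv LB (EB W g wsB) VT ((fun m => execOps W m fixBody)^[j] mem) ∧
      (∀ x, x < Qv W → ¬ (ad + 1 + j ≤ x ∧ x < ad + 1 + oq.length) →
        edec (EB W g wsB) ((fun m => execOps W m fixBody)^[j] mem) x = dmQ dmem wsB ad oq x) ∧
      (∀ i, j ≤ i → ∀ (hi : i < oq.length),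
        ((fun m => execOps W m fixBody)^[j] mem) (2 * Qv W + (ad + 1 + i)) = oq[i] % 2 ^ W) ∧
      ((fun m => execOps W m fixBody)^[j] mem) 26 = ad + 1 + j ∧
      ((fun m => execOps W m fixBody)^[j] mem) 27 = oq.length - j ∧
      ∀ c, c ≠ 12 → c ≠ 14 → c ≠ 26 → c ≠ 27 → ¬ (2 * Qv W ≤ c ∧ c < 4 * Qv W) →
        ((fun m => execOps W m fixBody)^[j] mem) c = mem c
  | 0, _ => ⟨hI, by simpa using hag, fun i _ hi => by simpa using hphys i hi, by simpa using h26,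
      by simpa using h27, fun _ _ _ _ _ _ => rfl⟩
  | j + 1, hj => by
      obtain ⟨iI, iag, iph, i26, i27, i_f⟩ := iterate_fixBody hW hwsB hVT hI hag hphys h26 h27 hadQ j
        (by omega)
      rw [Function.iterate_succ_apply']
      obtain ⟨jI, jag, jph, j26, j27, jf⟩ := execOps_fixBody hW hwsB hVT iI iag iph i26 i27 (by omega) hadQ
      exact ⟨jI, jag, jph, j26, j27, fun c c12 c14 c26 c27 cB => by
        rw [jf c c12 c14 c26 c27 cB, i_f c c12 c14 c26 c27 cB]⟩

end phases

/-! ## The whole forwarding block -/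

section whole

variable {W VT VB : ℕ}

set_option maxHeartbeats 1000000 in
/-- **Specification of the forwarding block.** Let the forwarding block for the emulated
instruction `query qa ql aa` of the inner reduction sit at `pos`, and let the target configuration
`e` (at `pos`) carry the `B`-side (generation `g`, emulated word size `wsB ≤ W`) for the
`VB`-bounded source memory `dmem`; let the oracle's answer to the emulated query segment
`q = readSeg dmem (qa.read dmem) (ql.read dmem)` have length `≤ VB`, where `2 VB + 2 ≤ Q`. Then the
target — run **with the same oracle** `O` — reaches the end of the block within `qfCost |q| |O q|`
steps; its `B`-side now carries the memory of the inner reduction *after* the query answered by the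
real oracle at the emulated word size (`WordRAM.step`: length at `aa`, words reduced modulo
`2 ^ wsB` after it, `dmQ`), its query log has grown by exactly `q`, its coins are unchanged, and only
registers `12, 14, 21–27` and `B`-region cells changed. [folklore] -/
theorem run_QF {P : Program} {pos : ℕ} {qa ql aa : Operand} {g wsB : ℕ}
    (hcode : CodeAt P pos (QF pos qa ql aa)) (hW : 8 ≤ W) (hwsB : wsB ≤ W) (hVT : VT + 1 = 2 ^ W)
    {e : Cfg} (hpc : e.pc = some pos) {dmem : ℕ → ℕ} (hB : BSide W g wsB VT dmem e.mem)
    (hdm : MemLE VB dmem) (hqa : qa.const ≤ VB) (hql : ql.const ≤ VB) (haa : aa.const ≤ VB)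
    (hVBQ : 2 * VB + 2 ≤ Qv W) {O : List ℕ → List ℕ}
    (hoV : (O (readSeg dmem (qa.read dmem) (ql.read dmem))).length ≤ VB) (ρ : ℕ → ℕ) :
    ∃ n, n ≤ qfCost (ql.read dmem) (O (readSeg dmem (qa.read dmem) (ql.read dmem))).length ∧
      ∃ e' : Cfg, run P W O ρ n e = some e' ∧ e'.pc = some (pos + qlenF) ∧
      BSide W g wsB VT
        (dmQ dmem wsB (aa.read dmem) (O (readSeg dmem (qa.read dmem) (ql.read dmem)))) e'.mem ∧
      e'.coinPos = e.coinPos ∧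
      e'.queries = e.queries ++ [readSeg dmem (qa.read dmem) (ql.read dmem)] ∧
      ∀ c, c ≠ 12 → c ≠ 14 → ¬ (21 ≤ c ∧ c ≤ 27) → ¬ (2 * Qv W ≤ c ∧ c < 4 * Qv W) →
        e'.mem c = e.mem c := by
  -- code placement
  simp only [QF] at hcode
  obtain ⟨hc0, hc5⟩ := codeAt_append_iff.1 hcode
  obtain ⟨hc0, hc4⟩ := codeAt_append_iff.1 hc0
  obtain ⟨hc0, hc3⟩ := codeAt_append_iff.1 hc0
  obtain ⟨hc0, hc2⟩ := codeAt_append_iff.1 hc0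
  obtain ⟨hc0, hc1⟩ := codeAt_append_iff.1 hc0
  simp only [List.length_append, List.length_map, loopBlock_length, F0_length, F1_length,
    normBody_length, F3_length, List.length_cons, List.length_nil, Nat.reduceAdd]
    at hc1 hc2 hc3 hc4 hc5
  -- constants
  have hQ := Qv_ge hW
  have h4Q := four_mul_Qv (show 2 ≤ W by omega)
  have h255 : 255 ≤ VT := by
    have : 2 ^ 8 ≤ 2 ^ W := Nat.pow_le_pow_right (by norm_num) hW
    omega
  have hVVT : VB ≤ VT := by omega
  set a := qa.read dmem with ha
  set L := ql.read dmem with hL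
  set ad := aa.read dmem with had
  have haV : a ≤ VB := Operand.read_le hdm qa hqa
  have hLV : L ≤ VB := Operand.read_le hdm ql hql
  have hadV : ad ≤ VB := Operand.read_le hdm aa haa
  set q := readSeg dmem a L with hq
  obtain ⟨pc0, m0, cp, qs⟩ := e
  simp only at hpc hB
  subst hpc
  -- phase 0 (36 steps)
  obtain ⟨B1, r21, r22, r23, f1⟩ := execOps_F0 hW hwsB hVT hB hdm (by omega) hVVT qa ql aa hqa hql haa
  have r1 := run_ops (P := P) (w := W) (O := O) (ρ := ρ) (F0 qa ql aa) hc0 (c := ⟨some pos, m0, cp, qs⟩) rfl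
  set m1 := execOps W m0 (F0 qa ql aa) with hm1
  -- phase 1 (4 steps)
  have h8₁ : m1 8 = 2 * Qv W := by have := B1.1.env.1; simpa using this
  obtain ⟨s24, s25, s26, s27, f2⟩ := execOps_F1 hW m1 r21 r22 r23 h8₁ (by omega) (by omega)
  have r2 := run_ops (P := P) (w := W) (O := O) (ρ := ρ) F1 hc1 (c := ⟨some (pos + 36), m1, cp, qs⟩) rfl
  set m2 := execOps W m1 F1 with hm2
  have T2 : MemLE VT m2 := fun c => by
    by_cases c24 : c = 24; · rw [c24, s24]; omega
    by_cases c25 : c = 25; · rw [c25, s25]; omega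
    by_cases c26 : c = 26; · rw [c26, s26]; omega
    by_cases c27 : c = 27; · rw [c27, s27]; omega
    rw [f2 c c24 c25 c26 c27]; exact B1.1.memT c
  have B2 : BSide W g wsB VT dmem m2 :=
    B1.of_frame hW T2 fun c hc => f2 c (by omega) (by omega) (by omega) (by omega)
  -- the normalisation loop (`L` rounds)
  have hnorm := iterate_normBody hW hwsB hVT B2 s26 s27 (show a + L ≤ Qv W by omega)
  have r3 := run_while (P := P) (w := W) (O := O) (ρ := ρ) hc2 L (c := ⟨some (pos + 40), m2, cp, qs⟩) rfl
    (fun j hj => by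
      show ((fun m => execOps W m normBody)^[j] m2) 27 ≠ 0
      rw [(hnorm j hj.le).2.2.1]; omega)
    (by show ((fun m => execOps W m normBody)^[L] m2) 27 = 0; rw [(hnorm L le_rfl).2.2.1]; omega)
  simp only [] at r3
  obtain ⟨B3, -, -, ph3, f3⟩ := hnorm L le_rfl
  set m3 := (fun m => execOps W m normBody)^[L] m2 with hm3
  -- the physical query segment and the registers of the query
  have hseg : readSeg m3 (2 * Qv W + a) L = q := by
    apply List.ext_getElem (by simp [hq])
    intro j hj _
    rw [readSeg_length] at hj
    simp only [hq, readSeg, List.getElem_map, List.getElem_range]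
    rw [Nat.add_assoc]; exact ph3 j hj
  have h24₃ : m3 24 = 2 * Qv W + a := by rw [f3 _ (by omega) (by omega) (by omega) (by omega) (by omega), s24]
  have h22₃ : m3 22 = L := by
    rw [f3 _ (by omega) (by omega) (by omega) (by omega) (by omega), f2 _ (by decide) (by decide) (by decide)
      (by decide), r22]
  have h25₃ : m3 25 = 2 * Qv W + ad := by rw [f3 _ (by omega) (by omega) (by omega) (by omega) (by omega), s25]
  have h23₃ : m3 23 = ad := by
    rw [f3 _ (by omega) (by omega) (by omega) (by omega) (by omega), f2 _ (by decide) (by decide) (by decide)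
      (by decide), r23]
  -- the real query (1 step)
  have hqI : P[pos + 54]? = some (.query (.dir 24) (.dir 22) (.dir 25)) := hc3.getElem?_zero
  have r4 : run P W O ρ 1 ⟨some (pos + 54), m3, cp, qs⟩ =
      some ⟨some (pos + 54 + 1), writeSeg (Function.update m3 (2 * Qv W + ad) ((O q).map (· % 2 ^ W)).length)
        (2 * Qv W + ad + 1) ((O q).map (· % 2 ^ W)), cp, qs ++ [q]⟩ := by
    rw [run_one, step_query (c := ⟨some (pos + 54), m3, cp, qs⟩) rfl hqI]
    simp only [Operand.read_dir, h24₃, h22₃, h25₃, hseg]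
  obtain ⟨I4, ag4, len4, word4, f4⟩ := query_effect (W := W) (VT := VT) (VB := VB) hW hVT B3.1 B3.2
    (ad := ad) (oq := O q) hadV hoV hVBQ
  set m4 := writeSeg (Function.update m3 (2 * Qv W + ad) ((O q).map (· % 2 ^ W)).length)
    (2 * Qv W + ad + 1) ((O q).map (· % 2 ^ W)) with hm4
  -- phase 3 (4 steps)
  have h25₄ : m4 25 = 2 * Qv W + ad := by rw [f4 _ (by omega), h25₃]
  have h23₄ : m4 23 = ad := by rw [f4 _ (by omega), h23₃]
  have h9₄ : m4 9 = 3 * Qv W := by have := I4.env.2.1; simpa using this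
  have h10₄ : m4 10 = g := by have := I4.env.2.2.1; simpa using this
  obtain ⟨t27, t26, tst, t14, f5⟩ := execOps_F3 hW m4 h25₄ h23₄ h9₄ h10₄ len4 (by omega)
  have r5 := run_ops (P := P) (w := W) (O := O) (ρ := ρ) F3 hc4 (c := ⟨some (pos + 55), m4, cp, qs ++ [q]⟩) rfl
  set m5 := execOps W m4 F3 with hm5
  have hgT : g ≤ VT := by rw [← h10₄]; exact I4.memT 10
  have I5 : TInv LB (EB W g wsB) VT m5 := by
    refine ⟨⟨?_, ?_, ?_, ?_⟩, fun x hx => ?_, fun c => ?_⟩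
    · rw [LB_rB, f5 8 (by decide) (by decide) (by decide) (by omega)]; exact I4.env.1
    · rw [LB_rS, f5 9 (by decide) (by decide) (by decide) (by omega)]; exact I4.env.2.1
    · rw [LB_rGen, f5 10 (by decide) (by decide) (by decide) (by omega)]; exact I4.env.2.2.1
    · rw [LB_rP, f5 11 (by decide) (by decide) (by decide) (by omega)]; exact I4.env.2.2.2
    · simp only [EB_Q] at hx
      simp only [EB_Sv, EB_Gv]
      rcases eq_or_ne x ad with rfl | hne
      · rw [tst]
      · rw [f5 _ (by omega) (by omega) (by omega) (by omega)]
        exact I4.stamp x (by simpa using hx)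
    · by_cases c27 : c = 27; · rw [c27, t27]; omega
      by_cases c26 : c = 26; · rw [c26, t26]; omega
      by_cases c14 : c = 14; · rw [c14, t14]; omega
      by_cases cS : c = 3 * Qv W + ad; · rw [cS, tst]; exact hgT
      rw [f5 c c14 c26 c27 cS]; exact I4.memT c
  have ag5 : ∀ x, x < Qv W → ¬ (ad + 1 ≤ x ∧ x < ad + 1 + (O q).length) →
      edec (EB W g wsB) m5 x = dmQ dmem wsB ad (O q) x := by
    intro x hx hnot
    rcases eq_or_ne x ad with rfl | hne
    · simp only [edec, EB_Sv, EB_Gv, EB_Bv]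
      rw [if_pos tst, f5 _ (by omega) (by omega) (by omega) (by omega), len4, dmQ_apply_ad]
    · rw [dmQ_apply_of_not _ _ _ _ (by omega), ← ag4 x hx (by omega)]
      exact edec_congr (f5 _ (by simp only [EB_Sv]; omega) (by simp only [EB_Sv]; omega)
        (by simp only [EB_Sv]; omega) (by simp only [EB_Sv]; omega))
        (f5 _ (by simp only [EB_Bv]; omega) (by simp only [EB_Bv]; omega)
        (by simp only [EB_Bv]; omega) (by simp only [EB_Bv]; omega))
  have ph5 : ∀ i (hi : i < (O q).length), m5 (2 * Qv W + (ad + 1 + i)) = (O q)[i] % 2 ^ W := by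
    intro i hi
    rw [f5 _ (by omega) (by omega) (by omega) (by omega)]
    exact word4 i hi
  -- the fix-up loop (`|O q|` rounds)
  have hfix := iterate_fixBody hW hwsB hVT I5 ag5 ph5 t26 t27 (by omega)
  have r6 := run_while (P := P) (w := W) (O := O) (ρ := ρ) hc5 (O q).length
    (c := ⟨some (pos + 59), m5, cp, qs ++ [q]⟩) rfl
    (fun j hj => by
      show ((fun m => execOps W m fixBody)^[j] m5) 27 ≠ 0
      rw [(hfix j hj.le).2.2.2.2.1]; omega)
    (by show ((fun m => execOps W m fixBody)^[(O q).length] m5) 27 = 0; rw [(hfix _ le_rfl).2.2.2.2.1]; omega)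
  simp only [] at r6
  obtain ⟨I6, ag6, -, -, -, f6⟩ := hfix _ le_rfl
  set m6 := (fun m => execOps W m fixBody)^[(O q).length] m5 with hm6
  have B6 : BSide W g wsB VT (dmQ dmem wsB ad (O q)) m6 :=
    ⟨I6, fun x hx => ag6 x (by simpa using hx) (by omega)⟩
  -- assemble
  simp only [F0_length, F1_length, normBody_length, F3_length, fixBody_length, Nat.add_assoc,
    Nat.reduceAdd] at r1 r2 r3 r4 r5 r6
  refine ⟨36 + (4 + ((L * 14 + 1) + (1 + (4 + ((O q).length * 11 + 1))))), ?_,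
    ⟨some (pos + qlenF), m6, cp, qs ++ [q]⟩, ?_, rfl, B6, rfl, rfl, fun c c12 c14 cR cB => ?_⟩
  · simp only [qfCost]; omega
  · have hrun := run_add_of_run _ _ _ _ r1 (run_add_of_run _ _ _ _ r2 (run_add_of_run _ _ _ _ r3
      (run_add_of_run _ _ _ _ r4 (run_add_of_run _ _ _ _ r5 r6))))
    convert hrun using 4; simp only [qlenF]
  · show m6 c = m0 c
    rw [f6 c c12 c14 (by omega) (by omega) cB, f5 c c14 (by omega) (by omega) (by omega), f4 c (by omega),
      f3 c c12 c14 (by omega) (by omega) cB, f2 c (by omega) (by omega) (by omega) (by omega),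
      f1 c c14 (by omega) (by omega) (by omega)]

end whole

end Inline

end Literature.Computability.Cryptography.WordRAM
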